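import Summits.Ventures.YMGap.RobustBall.PerturbedOneLink
import Summits.Ventures.YMGap.Thresholds.ZdSmoothingLipschitz
import HarnessLib

/-!
# Venture YMGap, track ROBUST-BALL — the `W`-COLLAR of a member of the `ℤ^d` ball: range of the perturbed
# energy, quasilocality of the member's kernels, and the cross-Lipschitz load in every outside link

HONEST FRAMING. WHAT THIS IS: a venture file (cell `pub-ymgap`, track Y2 ROBUST-BALL, seat ds-3),
strong-coupling LATTICE bookkeeping for a MEMBER `N β S_W + W` of the tier-1 `ℤ^d` ball (rb-p1's
`perturbedYM ρ β W supp`, `PerturbedSpecification.lean`; loads of rb-theory's design §2.1). Part 1 of the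
perturbed twin of the seat's Wilson file `Thresholds/ZdSmoothingLipschitz.lean`:
(1) the `W`-COLLAR `Λ ∪ ⋃_{e ∈ Λ} perturbedNbr supp e` of a finite link set `Λ` — the Wilson plaquette collar
    plus every listed interaction set through a link of `Λ` (`collar_subset_union_biUnion_perturbedNbr`), its
    size under a bound `m` on the one-link ranges (`card_union_biUnion_perturbedNbr_le`), the bound
    `m = 6(d−1) + #box(⌊R⌋₊)·d` from the range `R` of the member (`card_perturbedNbr_le_of_range`), and
    its `ℓ^∞`-geometry (`exists_near_of_mem_union_biUnion_perturbedNbr`);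
(2) RANGE: the finite-volume Hamiltonian `H^W_Λ` and the perturbed energy `-β S_Λ - H^W_Λ` depend only on
    the links of the `W`-collar (`dependsOn_hamiltonianIn_collar`, `dependsOn_perturbedEnergy_collar`;
    `Potential.IsSupportedBy`, Georgii (2.11));
(3) the member's kernel average `γ^W_Λ F` (`specAvg`) is a tilted product-Haar integral
    (`specAvg_perturbedYM_eq_tilted`) and is QUASILOCAL with the `W`-collar
    (`dependsOn_specAvg_perturbedYM`, Georgii (2.15));
(4) `SU(N)`: `H^W_Λ` is `#Λ · ε₁`-Lipschitz (Frobenius) in every OUTSIDE link, `ε₁` the CROSS-LIPSCHITZ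
    LOAD of the member (`abs_hamiltonianIn_sub_le_of_eq_off`), hence the perturbed energy is
    `(|β|·2(d−1)√N + ℓ)`-Lipschitz there (`abs_perturbedEnergy_sub_le_of_eq_off`).
WHAT IT IS NOT: no door, no row, no number of the cell; nothing about the continuum or the Clay problem.
Consumed by `PerturbedSmoothing` (the smoothing is a Lipschitz cylinder function) and the bridge
`MassGapOnBallMassive` (every DLR state of a member is massive).

References: H.-O. Georgii, Gibbs Measures and Phase Transitions (2011), Def. 1.23, (2.11), (2.15);
S. Friedli, Y. Velenik (2017) Lemma 6.28; rb-theory, `HOME/rb/ROBUST-BALL-DESIGN.md` v0.2 §2.1, §3.2.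
-/

noncomputable section

open MeasureTheory ProbabilityTheory Function Finset Filter Topology
open scoped NNReal
open Literature.Probability.LatticeModels
open Literature.Probability.LatticeModels.DobrushinMetric
open Literature.MathematicalPhysics.QuantumLattice
open Literature.MathematicalPhysics.QuantumFieldTheory hiding ZdEdge
open Literature.MathematicalPhysics.QuantumFieldTheory.Balaban1983to89
open Literature.MathematicalPhysics.QuantumFieldTheory.Balaban1983to89.StrongCouplingTorusWindow
open Summit.Ventures.YMGap.ZdSmoothing

namespace Summit.Ventures.YMGap.RobustBall

variable {d N : ℕ}

/-! ### The `W`-collar: plaquette collar and listed interaction sets through the links of `Λ` -/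

section Collar

variable {G : Type*}

/-- The Wilson plaquette collar of `Λ` lies inside `Λ ∪ ⋃_{e ∈ Λ} perturbedNbr supp e`
(plaquette neighbours are in the one-link range, `linkPlaqNbr_subset_perturbedNbr`). -/
theorem collar_subset_union_biUnion_perturbedNbr (supp : Finset (ZdEdge d) → Finset (Finset (ZdEdge d)))
    (Λ : Finset (ZdEdge d)) :
    (plaquettesTouching Λ).biUnion plaquetteEdges ⊆ Λ ∪ Λ.biUnion (perturbedNbr supp) := by
  classical
  intro z hz
  obtain ⟨p, hp, hzp⟩ := Finset.mem_biUnion.1 hz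
  obtain ⟨e, he⟩ := mem_plaquettesTouching_iff.1 hp
  rw [Finset.mem_inter] at he
  by_cases hze : z = e
  · exact Finset.mem_union_left _ (hze ▸ he.2)
  · refine Finset.mem_union_right _ (Finset.mem_biUnion.2 ⟨e, he.2, ?_⟩)
    exact linkPlaqNbr_subset_perturbedNbr supp e (mem_linkPlaqNbr_iff.2 ⟨hze, p, he.1, hzp⟩)

/-- **Range of the finite-volume Hamiltonian**: `H^W_Λ = ∑_{X ∈ supp Λ, X ∩ Λ ≠ ∅} W_X` depends only on
the links of `Λ ∪ ⋃_{e ∈ Λ} perturbedNbr supp e` — a listed set `X` meeting `Λ` at `e` with `W_X ≠ 0` is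
listed at `e` (`Potential.IsSupportedBy`), so its links other than `e` are in `perturbedNbr supp e`
(Georgii 2011, (2.11)). -/
theorem dependsOn_hamiltonianIn_collar {W : Potential (ZdEdge d) G}
    (hWdep : ∀ X, DependsOn (W X) (↑X : Set (ZdEdge d)))
    {supp : Finset (ZdEdge d) → Finset (Finset (ZdEdge d))} (hsupp : W.IsSupportedBy supp)
    (Λ : Finset (ZdEdge d)) :
    DependsOn (hamiltonianIn W supp Λ) (↑(Λ ∪ Λ.biUnion (perturbedNbr supp)) : Set (ZdEdge d)) := by
  classical
  intro U V hUV
  unfold hamiltonianIn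
  refine Finset.sum_congr rfl fun X hX => ?_
  obtain ⟨-, hXΛ⟩ := Finset.mem_filter.1 hX
  by_cases hW0 : W X = 0
  · simp [hW0]
  obtain ⟨e, he⟩ := hXΛ
  rw [Finset.mem_inter] at he
  have hXe : X ∈ supp {e} :=
    hsupp {e} X ⟨e, Finset.mem_inter.2 ⟨he.1, Finset.mem_singleton_self e⟩⟩ hW0
  refine hWdep X fun y hy => hUV y ?_
  have hy' : y ∈ X := Finset.mem_coe.1 hy
  rw [Finset.coe_union, Set.mem_union, Finset.mem_coe, Finset.mem_coe, Finset.mem_biUnion]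
  by_cases hye : y = e
  · exact Or.inl (hye ▸ he.2)
  · exact Or.inr ⟨e, he.2, mem_perturbedNbr_of_mem_supp hXe he.1 hy' hye⟩

/-- **Range of the perturbed energy**: `-β S_Λ - H^W_Λ` depends only on the links of the `W`-collar
`Λ ∪ ⋃_{e ∈ Λ} perturbedNbr supp e` (Wilson part: `isCylinder_wilsonBoundaryAction_holds` and
`collar_subset_union_biUnion_perturbedNbr`; interaction part: `dependsOn_hamiltonianIn_collar`). -/
theorem dependsOn_perturbedEnergy_collar [Group G] (ρ : G →* Matrix (Fin N) (Fin N) ℂ) (β : ℝ)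
    {W : Potential (ZdEdge d) G} (hWdep : ∀ X, DependsOn (W X) (↑X : Set (ZdEdge d)))
    {supp : Finset (ZdEdge d) → Finset (Finset (ZdEdge d))} (hsupp : W.IsSupportedBy supp)
    (Λ : Finset (ZdEdge d)) :
    DependsOn (perturbedEnergy ρ β W supp Λ) (↑(Λ ∪ Λ.biUnion (perturbedNbr supp)) : Set (ZdEdge d)) := by
  intro U V hUV
  have hS : wilsonBoundaryAction ρ Λ U = wilsonBoundaryAction ρ Λ V :=
    isCylinder_wilsonBoundaryAction_holds (G := G) ρ Λ fun e he =>
      hUV e (Finset.mem_coe.2 (collar_subset_union_biUnion_perturbedNbr supp Λ (Finset.mem_coe.1 he)))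
  have hH := dependsOn_hamiltonianIn_collar hWdep hsupp Λ hUV
  simp only [perturbedEnergy, hS, hH]

/-- Every link of the `W`-collar of `Λ` is based within `ℓ^∞`-distance `r` of the base point of a link of
`Λ`, as soon as every one-link range `perturbedNbr supp e` is (`r` a natural number; componentwise form). -/
theorem exists_near_of_mem_union_biUnion_perturbedNbr
    {supp : Finset (ZdEdge d) → Finset (Finset (ZdEdge d))} {r : ℕ}
    (hr : ∀ e, ∀ y ∈ perturbedNbr supp e, ‖e.1 - y.1‖ ≤ (r : ℝ)) {Λ : Finset (ZdEdge d)} {a : ZdEdge d}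
    (ha : a ∈ Λ ∪ Λ.biUnion (perturbedNbr supp)) :
    ∃ e₀ ∈ Λ, ∀ j, |a.1 j - e₀.1 j| ≤ (r : ℤ) := by
  rcases Finset.mem_union.1 ha with h | h
  · exact ⟨a, h, fun j => by simp⟩
  · obtain ⟨e₀, he₀, hae₀⟩ := Finset.mem_biUnion.1 h
    refine ⟨e₀, he₀, fun j => ?_⟩
    have h1 : ‖(e₀.1 - a.1) j‖ ≤ (r : ℝ) := (norm_le_pi_norm (e₀.1 - a.1) j).trans (hr e₀ a hae₀)
    rw [Pi.sub_apply, Int.norm_eq_abs, Int.cast_sub] at h1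
    rw [abs_sub_comm]
    exact_mod_cast h1

/-- **Size of the `W`-collar**: if every one-link range has at most `m` links then
`#(Λ ∪ ⋃_{e ∈ Λ} perturbedNbr supp e) ≤ (1 + m) · #Λ`. -/
theorem card_union_biUnion_perturbedNbr_le {supp : Finset (ZdEdge d) → Finset (Finset (ZdEdge d))}
    {m : ℕ} (hm : ∀ e, (perturbedNbr supp e).card ≤ m) (Λ : Finset (ZdEdge d)) :
    (Λ ∪ Λ.biUnion (perturbedNbr supp)).card ≤ (1 + m) * Λ.card :=
  calc (Λ ∪ Λ.biUnion (perturbedNbr supp)).card ≤ Λ.card + (Λ.biUnion (perturbedNbr supp)).card :=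
        Finset.card_union_le _ _
    _ ≤ Λ.card + ∑ e ∈ Λ, (perturbedNbr supp e).card := Nat.add_le_add_left Finset.card_biUnion_le _
    _ ≤ Λ.card + ∑ _e ∈ Λ, m := Nat.add_le_add_left (Finset.sum_le_sum fun e _ => hm e) _
    _ = (1 + m) * Λ.card := by rw [Finset.sum_const, smul_eq_mul]; ring

/-- **The one-link range under a range bound**: if every listed set through `e` containing `e` stays within
`ℓ^∞`-distance `R` of `e` (the `range` field of rb-p1's `MemBallZd`), then
`#(perturbedNbr supp e) ≤ 6(d−1) + #(box d ⌊R⌋₊) · d` — the plaquette neighbours plus the links based in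
the `ℓ^∞`-box of radius `⌊R⌋₊` around the base point of `e`. -/
theorem card_perturbedNbr_le_of_range {supp : Finset (ZdEdge d) → Finset (Finset (ZdEdge d))} {R : ℝ}
    (hR : ∀ e, ∀ X ∈ supp {e}, e ∈ X → ∀ y ∈ X, ‖e.1 - y.1‖ ≤ R) (e : ZdEdge d) :
    (perturbedNbr supp e).card ≤ 6 * (d - 1) + (box d ⌊R⌋₊).card * d := by
  classical
  set Xpart : Finset (ZdEdge d) := ((supp {e}).filter fun X => e ∈ X).biUnion id with hXpart
  have hsub : perturbedNbr supp e ⊆ linkPlaqNbr e ∪ Xpart := Finset.erase_subset _ _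
  have hXcard : Xpart.card ≤ ((box d ⌊R⌋₊) ×ˢ (Finset.univ : Finset (Fin d))).card := by
    refine Finset.card_le_card_of_injOn (fun y : ZdEdge d => (e.1 - y.1, y.2)) ?_ ?_
    · intro y hy
      obtain ⟨X, hX, hyX⟩ := Finset.mem_biUnion.1 hy
      obtain ⟨hXs, heX⟩ := Finset.mem_filter.1 hX
      have hnorm : ‖e.1 - y.1‖ ≤ R := hR e X hXs heX y hyX
      rw [Site.norm_eq_supNorm] at hnorm
      refine Finset.mem_coe.2 (Finset.mem_product.2 ⟨mem_box_iff_supNorm_le.2 ?_, Finset.mem_univ _⟩)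
      exact Nat.le_floor hnorm
    · intro y _ y' _ h
      simp only [Prod.mk.injEq, sub_right_inj] at h
      exact Prod.ext h.1 h.2
  calc (perturbedNbr supp e).card ≤ (linkPlaqNbr e ∪ Xpart).card := Finset.card_le_card hsub
    _ ≤ (linkPlaqNbr e).card + Xpart.card := Finset.card_union_le _ _
    _ ≤ 6 * (d - 1) + (box d ⌊R⌋₊).card * d := by
        refine Nat.add_le_add (card_linkPlaqNbr_le e) (hXcard.trans ?_)
        rw [Finset.card_product, Finset.card_univ, Fintype.card_fin]

end Collar

/-! ### The kernel average as a tilted product-Haar integral; quasilocality with the `W`-collar -/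

section Kernel

variable {G : Type*} [Group G] [TopologicalSpace G] [IsTopologicalGroup G] [CompactSpace G]
  [MeasurableSpace G] [BorelSpace G] [SecondCountableTopology G] (ρ : G →* Matrix (Fin N) (Fin N) ℂ)

/-- **The member's kernel average as a tilted product-Haar integral**:
`γ^W_Λ F (η) = ∫ F(ζ ∨ η) μ_η(dζ)` with `μ_η = Haar^{⊗Λ}.tilted (ζ ↦ -β S_Λ(ζ ∨ η) - H^W_Λ(ζ ∨ η))`
(change of variables `map_tilted_comp`; the perturbed twin of `ZdSmoothing.specAvg_ymSpecification_eq_tilted`). -/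
theorem specAvg_perturbedYM_eq_tilted (hρ : Continuous ρ) (β : ℝ) {W : Potential (ZdEdge d) G}
    (hWm : ∀ X, Measurable (W X)) (supp : Finset (ZdEdge d) → Finset (Finset (ZdEdge d)))
    (Λ : Finset (ZdEdge d)) {F : LGConfig d G → ℝ} (hFm : Measurable F) (η : LGConfig d G) :
    specAvg (perturbedYM ρ β W supp) Λ F η =
      ∫ ζ, F (glueWith Λ ζ η) ∂((Measure.pi fun _ : ↥Λ => haarProbability G).tilted
        fun ζ => perturbedEnergy ρ β W supp Λ (glueWith Λ ζ η)) := by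
  unfold specAvg perturbedYM
  rw [← map_tilted_comp _ (measurable_glueWith Λ η) (measurable_perturbedEnergy ρ hρ β hWm supp Λ),
    integral_map (measurable_glueWith Λ η).aemeasurable hFm.aestronglyMeasurable]
  rfl

/-- **Quasilocality of the member's kernels with the `W`-collar** (Georgii 2011, (2.15); Friedli–Velenik
2017, Lemma 6.28): for `F` measurable and depending only on the links of `S₀`, the kernel average
`γ^W_Λ F` depends on the boundary condition only through `S₀ ∪ Λ ∪ ⋃_{e ∈ Λ} perturbedNbr supp e`. -/
theorem dependsOn_specAvg_perturbedYM (hρ : Continuous ρ) (β : ℝ) {W : Potential (ZdEdge d) G}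
    (hWm : ∀ X, Measurable (W X)) (hWdep : ∀ X, DependsOn (W X) (↑X : Set (ZdEdge d)))
    {supp : Finset (ZdEdge d) → Finset (Finset (ZdEdge d))} (hsupp : W.IsSupportedBy supp)
    (Λ : Finset (ZdEdge d)) {F : LGConfig d G → ℝ} (hFm : Measurable F) {S₀ : Finset (ZdEdge d)}
    (hFS : DependsOn F (↑S₀ : Set (ZdEdge d))) :
    DependsOn (specAvg (perturbedYM ρ β W supp) Λ F)
      (↑(S₀ ∪ (Λ ∪ Λ.biUnion (perturbedNbr supp))) : Set (ZdEdge d)) := by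
  intro η η' h
  have hT : ∀ e ∈ S₀ ∪ (Λ ∪ Λ.biUnion (perturbedNbr supp)), η e = η' e :=
    fun e he => h e (Finset.mem_coe.2 he)
  have hF' : ∀ ζ : ↥Λ → G, F (glueWith Λ ζ η) = F (glueWith Λ ζ η') := fun ζ =>
    hFS fun e he => glueWith_congr_of_eqOn hT ζ (Finset.mem_union_left _ (Finset.mem_coe.1 he))
  have hE' : ∀ ζ : ↥Λ → G, perturbedEnergy ρ β W supp Λ (glueWith Λ ζ η) =
      perturbedEnergy ρ β W supp Λ (glueWith Λ ζ η') := fun ζ =>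
    dependsOn_perturbedEnergy_collar ρ β hWdep hsupp Λ fun e he =>
      glueWith_congr_of_eqOn hT ζ (Finset.mem_union_right _ (Finset.mem_coe.1 he))
  simp only [specAvg_perturbedYM_eq_tilted ρ hρ β hWm supp Λ hFm, hF', hE']

/-- The case `S₀ = Λ`: `γ^W_Λ F` of an `F` depending only on `Λ` is a cylinder function on the
`W`-collar `Λ ∪ ⋃_{e ∈ Λ} perturbedNbr supp e`. -/
theorem dependsOn_specAvg_perturbedYM_collar (hρ : Continuous ρ) (β : ℝ) {W : Potential (ZdEdge d) G}
    (hWm : ∀ X, Measurable (W X)) (hWdep : ∀ X, DependsOn (W X) (↑X : Set (ZdEdge d)))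
    {supp : Finset (ZdEdge d) → Finset (Finset (ZdEdge d))} (hsupp : W.IsSupportedBy supp)
    (Λ : Finset (ZdEdge d)) {F : LGConfig d G → ℝ} (hFm : Measurable F)
    (hFdep : DependsOn F (↑Λ : Set (ZdEdge d))) :
    DependsOn (specAvg (perturbedYM ρ β W supp) Λ F)
      (↑(Λ ∪ Λ.biUnion (perturbedNbr supp)) : Set (ZdEdge d)) := by
  have h := dependsOn_specAvg_perturbedYM ρ hρ β hWm hWdep hsupp Λ hFm hFdep
  rwa [← Finset.union_assoc, Finset.union_idempotent] at h

end Kernel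

/-! ### `SU(N)`: the cross-Lipschitz load controls the Hamiltonian in every outside link -/

section Loads

variable {W : Potential (ZdEdge d) (Matrix.specialUnitaryGroup (Fin N) ℂ)}
  {supp : Finset (ZdEdge d) → Finset (Finset (ZdEdge d))}

/-- **The finite-volume Hamiltonian is `#Λ · ε₁`-Lipschitz in every OUTSIDE link** (Frobenius distance),
from the per-link Lipschitz witnesses `lip` and the CROSS-LIPSCHITZ LOAD `ε₁` of the member: if
`U = V` off `y ∉ Λ` then `|H^W_Λ(U) − H^W_Λ(V)| ≤ #Λ · ε₁ · ‖U_y − V_y‖_F`. Only listed sets `X ∋ y`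
meeting `Λ` with `W_X ≠ 0` contribute; such an `X` is listed at a link `e ∈ X ∩ Λ`
(`Potential.IsSupportedBy`) with `y ∈ perturbedNbr supp e`, and the `y`-column of the cross load at `e`
is at most `ε₁`. -/
theorem abs_hamiltonianIn_sub_le_of_eq_off (hWdep : ∀ X, DependsOn (W X) (↑X : Set (ZdEdge d)))
    (hsupp : W.IsSupportedBy supp) {lip : Finset (ZdEdge d) → ZdEdge d → ℝ}
    (hlip : ∀ X, IsLipBound suFrobDist (W X) (lip X)) {ε₁ : ℝ}
    (hΛ : ∀ e, ∑ y ∈ perturbedNbr supp e, ∑ X ∈ (supp {e}).filter (fun X => e ∈ X), lip X y ≤ ε₁)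
    (Λ : Finset (ZdEdge d)) {y : ZdEdge d} (hy : y ∉ Λ)
    {U V : LGConfig d (Matrix.specialUnitaryGroup (Fin N) ℂ)} (hUV : ∀ z, z ≠ y → U z = V z) :
    |hamiltonianIn W supp Λ U - hamiltonianIn W supp Λ V| ≤ Λ.card * ε₁ * suFrobDist (U y) (V y) := by
  classical
  set δ : ℝ := suFrobDist (U y) (V y) with hδ
  have hδ0 : 0 ≤ δ := suFrobDist_nonneg _ _
  have hlip0 : ∀ X z, 0 ≤ lip X z := fun X z => (hlip X).nonneg z
  have hε₁ : 0 ≤ ε₁ := (Finset.sum_nonneg fun y' _ => Finset.sum_nonneg fun X _ => hlip0 X y').trans (hΛ y)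
  set A : Finset (Finset (ZdEdge d)) := (supp Λ).filter fun X => (X ∩ Λ).Nonempty with hA
  set A' : Finset (Finset (ZdEdge d)) := A.filter fun X => y ∈ X ∧ W X ≠ 0 with hA'
  -- the terms outside `A'` vanish, those in `A'` are bounded by `lip X y · δ`
  have hzero : ∀ X ∈ A.filter (fun X => ¬ (y ∈ X ∧ W X ≠ 0)), |W X U - W X V| = 0 := by
    intro X hX
    obtain ⟨-, hXP⟩ := Finset.mem_filter.1 hX
    rw [abs_eq_zero, sub_eq_zero]
    by_cases hyX : y ∈ X
    · have hW0 : W X = 0 := by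
        by_contra h
        exact hXP ⟨hyX, h⟩
      simp [hW0]
    · exact hWdep X fun z hz => hUV z fun hzy => hyX (hzy ▸ Finset.mem_coe.1 hz)
  have hbound : ∀ X ∈ A', |W X U - W X V| ≤ lip X y * δ := fun X _ => (hlip X).le y U V hUV
  -- every `X ∈ A'` is listed at a link of `X ∩ Λ`
  set eX : Finset (ZdEdge d) → ZdEdge d := fun X => if h : (X ∩ Λ).Nonempty then h.choose else y
    with heX
  have hprop : ∀ X ∈ A', eX X ∈ X ∧ eX X ∈ Λ ∧ X ∈ supp {eX X} ∧ y ∈ X := by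
    intro X hX
    obtain ⟨hXA, hyX, hW0⟩ := Finset.mem_filter.1 hX
    obtain ⟨-, hXΛ⟩ := Finset.mem_filter.1 hXA
    have he : eX X ∈ X ∩ Λ := by
      rw [heX]
      simp only [dif_pos hXΛ]
      exact hXΛ.choose_spec
    obtain ⟨heX', heΛ⟩ := Finset.mem_inter.1 he
    exact ⟨heX', heΛ, hsupp {eX X} X ⟨eX X, Finset.mem_inter.2 ⟨heX', Finset.mem_singleton_self _⟩⟩ hW0,
      hyX⟩
  have hmaps : ∀ X ∈ A', eX X ∈ Λ := fun X hX => (hprop X hX).2.1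
  -- the fibre over `e ∈ Λ` is controlled by the `y`-column of the cross load at `e`
  have hfib : ∀ e ∈ Λ, ∑ X ∈ A'.filter (fun X => eX X = e), lip X y * δ ≤ ε₁ * δ := by
    intro e he
    have hyne : y ≠ e := fun h => hy (h ▸ he)
    by_cases hype : y ∈ perturbedNbr supp e
    · have hsub : A'.filter (fun X => eX X = e) ⊆ (supp {e}).filter fun X => e ∈ X := by
        intro X hX
        obtain ⟨hXA', hXe⟩ := Finset.mem_filter.1 hX
        obtain ⟨h1, -, h3, -⟩ := hprop X hXA'
        rw [hXe] at h1 h3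
        exact Finset.mem_filter.2 ⟨h3, h1⟩
      calc ∑ X ∈ A'.filter (fun X => eX X = e), lip X y * δ
          ≤ ∑ X ∈ (supp {e}).filter (fun X => e ∈ X), lip X y * δ :=
            Finset.sum_le_sum_of_subset_of_nonneg hsub fun X _ _ => mul_nonneg (hlip0 X y) hδ0
        _ = (∑ X ∈ (supp {e}).filter (fun X => e ∈ X), lip X y) * δ := by rw [Finset.sum_mul]
        _ ≤ ε₁ * δ := by
            refine mul_le_mul_of_nonneg_right (le_trans ?_ (hΛ e)) hδ0
            exact Finset.single_le_sum (f := fun y' => ∑ X ∈ (supp {e}).filter (fun X => e ∈ X), lip X y')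
              (fun y' _ => Finset.sum_nonneg fun X _ => hlip0 X y') hype
    · have hempty : A'.filter (fun X => eX X = e) = ∅ := by
        refine Finset.filter_eq_empty_iff.2 fun X hXA' hXe => hype ?_
        obtain ⟨h1, -, h3, h4⟩ := hprop X hXA'
        rw [hXe] at h1 h3
        exact mem_perturbedNbr_of_mem_supp h3 h1 h4 hyne
      rw [hempty, Finset.sum_empty]
      exact mul_nonneg hε₁ hδ0
  calc |hamiltonianIn W supp Λ U - hamiltonianIn W supp Λ V|
      = |∑ X ∈ A, (W X U - W X V)| := by
        unfold hamiltonianIn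
        rw [← Finset.sum_sub_distrib]
    _ ≤ ∑ X ∈ A, |W X U - W X V| := Finset.abs_sum_le_sum_abs _ _
    _ = ∑ X ∈ A', |W X U - W X V| +
          ∑ X ∈ A.filter (fun X => ¬ (y ∈ X ∧ W X ≠ 0)), |W X U - W X V| :=
        (Finset.sum_filter_add_sum_filter_not A (fun X => y ∈ X ∧ W X ≠ 0) _).symm
    _ = ∑ X ∈ A', |W X U - W X V| := by rw [Finset.sum_eq_zero hzero, add_zero]
    _ ≤ ∑ X ∈ A', lip X y * δ := Finset.sum_le_sum hbound
    _ = ∑ e ∈ Λ, ∑ X ∈ A'.filter (fun X => eX X = e), lip X y * δ :=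
        (Finset.sum_fiberwise_of_maps_to hmaps _).symm
    _ ≤ ∑ _e ∈ Λ, ε₁ * δ := Finset.sum_le_sum hfib
    _ = Λ.card * ε₁ * δ := by rw [Finset.sum_const, nsmul_eq_mul]; ring

/-- **One-link Lipschitz bound for the perturbed energy in an OUTSIDE link** (`SU(N)`, fundamental
representation): if `H^W_Λ` is `ℓ`-Lipschitz in every outside link and `U = V` off `y ∉ Λ`, then
`|(-β S_Λ - H^W_Λ)(U) − (-β S_Λ - H^W_Λ)(V)| ≤ (|β| · 2(d−1)√N + ℓ) ‖U_y − V_y‖_F`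
(Wilson part: `ZdSmoothing.abs_wilsonBoundaryAction_sub_le_of_eq_off`). -/
theorem abs_perturbedEnergy_sub_le_of_eq_off (β : ℝ) (Λ : Finset (ZdEdge d)) {ℓ : ℝ}
    (hH : ∀ y, y ∉ Λ → ∀ U V : LGConfig d (Matrix.specialUnitaryGroup (Fin N) ℂ),
      (∀ z, z ≠ y → U z = V z) →
        |hamiltonianIn W supp Λ U - hamiltonianIn W supp Λ V| ≤ ℓ * suFrobDist (U y) (V y))
    {y : ZdEdge d} (hy : y ∉ Λ) {U V : LGConfig d (Matrix.specialUnitaryGroup (Fin N) ℂ)}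
    (hUV : ∀ z, z ≠ y → U z = V z) :
    |perturbedEnergy (fundamentalRep (Fin N)) β W supp Λ U -
        perturbedEnergy (fundamentalRep (Fin N)) β W supp Λ V| ≤
      (|β| * (((2 * (d - 1) : ℕ) : ℝ) * Real.sqrt N) + ℓ) * suFrobDist (U y) (V y) := by
  have h1 := abs_wilsonBoundaryAction_sub_le_of_eq_off (N := N) Λ hUV
  have h2 := hH y hy U V hUV
  have e : perturbedEnergy (fundamentalRep (Fin N)) β W supp Λ U -
      perturbedEnergy (fundamentalRep (Fin N)) β W supp Λ V =
      -(β * (wilsonBoundaryAction (fundamentalRep (Fin N)) Λ U -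
          wilsonBoundaryAction (fundamentalRep (Fin N)) Λ V) +
        (hamiltonianIn W supp Λ U - hamiltonianIn W supp Λ V)) := by
    unfold perturbedEnergy; ring
  rw [e, abs_neg]
  refine (abs_add_le _ _).trans ?_
  rw [abs_mul, add_mul]
  refine add_le_add ?_ h2
  calc |β| * |wilsonBoundaryAction (fundamentalRep (Fin N)) Λ U -
          wilsonBoundaryAction (fundamentalRep (Fin N)) Λ V|
      ≤ |β| * (((2 * (d - 1) : ℕ) : ℝ) * (Real.sqrt N * suFrobDist (U y) (V y))) :=
        mul_le_mul_of_nonneg_left h1 (abs_nonneg β)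
    _ = |β| * (((2 * (d - 1) : ℕ) : ℝ) * Real.sqrt N) * suFrobDist (U y) (V y) := by ring

end Loads

end Summit.Ventures.YMGap.RobustBall

end
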